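import Literature.Computability.MetaComplexity.UPSearchScheme
import Literature.Computability.MetaComplexity.UPSearchNP
import Literature.Computability.MetaComplexity.UPSearchMachines
import Literature.Computability.MetaComplexity.KtApproximation
import Literature.Computability.MetaComplexity.AccProbTester
import Literature.Computability.MetaComplexity.SearchHeuristicSchemes
import Literature.Computability.Complexity.ReductionsProofs
import HarnessLib

/-!
# Complexity meta: Thm. 8.9 of Hirahara 2021 for `UP` (and Cor. 8.12 for `UP`), assembled from its five ingredients

Topic `Literature/Computability/MetaComplexity`. The named fact `Hirahara2021_UP_searchUHS_of_Avg1P`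
(`SearchHeuristicSchemes.lean`) — Thm. 8.9 of S. Hirahara, *Average-case hardness of NP from
exponential worst-case hardness assumptions* (STOC 2021; ECCC TR21-058) for `UP`-type verifiers: *if
`coNP × {U, T} ⊆ Avg¹_{1-n^{-c}} P` for some `c`, then the search version of every `UP`-type verifier
admits a universal heuristic scheme* (Def. 8.8, `UniversalMachine.HasSearchUHS`) — is the single named
fact of §8 in the tree (Cor. 8.12 for `UP` is the proved theorem `Hirahara2021_UP_hasUHS_of_Avg1P_of_search`
with this fact as hypothesis; D-0026 reviews of 2026-08-15) and the deepest unproved step behind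
`hirahara_UP_DistNP` (Thm. 1.6 (1)) and `Hirahara2021_hasUHS_of_mem_UP` (Lemma 2.2 (1)). This file
PROVES it from the five results of §3–§5 that its printed proof invokes, all of Hirahara's own
arguments (the scheme, Claims 8.10–8.11, the parameters, the machines) being formalised in
`UPSearchScheme.lean`, `UPSearchNP.lean`, `UPSearchMachines.lean`, `KtApproximation.lean` and
`AccProbTester.lean`:

* **Lemma 5.1** — `Hirahara2021_gapKvsK_mem_PromiseP` (named fact, `LanguageCompression.lean`);
* **Thm. 4.2** — `Hirahara2021_languageCompression` (named fact, `LanguageCompression.lean`),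
  applied to the ensemble `L'` (`upLang`, in `NP` by `UPSearchNP.lean`);
* **Thm. 5.2** (weak symmetry of information) in the form printed on p. 30 — the hypothesis `h52 :
  ∀ U, (∃ c, coNP × {U,T} ⊆ Avg¹_{1-n^{-c}}P) → ∃ p₀ p_w, ∀ n m, ∀ t ≥ p₀(nm), ∀ ε = 1/e, ∀ x ∈ {0,1}ⁿ,
  Pr_{w ← {0,1}^m}[K^t(xw) + log p_w(t/ε) ≥ K^{p_w(t/ε)}(x) + m] ≥ 1 - ε` (stated inline; it was the named
  fact of `LanguageCompression.lean` until the D-0026 review of 2026-08-15 merged it back into this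
  proof obligation, see below);
* **Lemma 3.4** in the promise form in which the paper uses it ("`pr-BPP = pr-P` by Lemma 3.4",
  p. 27; Eq. (13)) — the hypothesis `h34 : (∃ c, coNP × {U,T} ⊆ Avg¹_{1-n^{-c}}P) → PromiseBPP' ⊆ PromiseP`;
* **Thm. 3.12** (reconstruction for `DP_k`) in the enumeration form printed after it ("in time
  `poly(ns2^k/δ)`, given a description of the circuit `D`, one can enumerate a list of strings that
  contains `x`"), for the tests `w ↦ [⟨a, w⟩ ∈ D₀]`, `D₀ ∈ P` — the hypothesis `h312`.

The last three are stated inline as hypotheses (they are not vendored as named facts); the first two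
are the tree's named facts. Main results:

* `UniversalMachine.hasSearchUHS_of_ingredients` — for one `U`, `R ∈ P` with at most one
  certificate per input: the five ingredients (as data about `U`) give `U.HasSearchUHS R p`;
* `Hirahara2021_UP_searchUHS_of_Avg1P_of` — **Thm. 8.9 (`UP` form, the named fact) from Lemma 5.1,
  Thm. 4.2 (named facts), Thm. 5.2 (printed form), Lemma 3.4 (promise form) and Thm. 3.12 (enumeration
  form)**: the discharge `Hirahara2021_UP_searchUHS_of_Avg1P_holds` is this theorem fed the two `_holds`
  and proofs of `h52`, `h34`, `h312`, once those exist (`UniversalMachine.weakSOI_failure_le` turns the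
  printed success form of Thm. 5.2 into the failure form consumed by the scheme);
* `Hirahara2021_UP_hasUHS_of_Avg1P_of_ingredients` — **Cor. 8.12 (`UP` form, written out exactly as
  the conclusion of `Hirahara2021_UP_hasUHS_of_Avg1P_of_search`) from the same five ingredients**.

## Size of what remains (D-0026 bad-split reviews of `Hirahara2021_UP_searchUHS_of_Avg1P` and of Thm. 5.2, 2026-08-15)

The fact was checked against ECCC TR21-058 (Def. 8.8 / Thm. 8.9, p. 40; Fact 8.4, p. 37): faithful
(weaker than print), not mis-stated. It is honestly XL and NOT provable inline from the tree: of the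
five ingredients, Lemma 3.4 is a theory of its own (BCGL92 `NE = E` + KS04 `pr-MA = pr-NP` + BFP05 +
the IW97 generator, p. 20) and is not vendored; Thm. 3.12 (pp. 23–25: Goldreich–Levin local list
decoding, the hybrid argument of Lemma 3.14, derandomised by that generator) is not vendored;
Thm. 4.2 (pp. 26–29) uses Lemma 3.4, Lemma 3.6, the Goldwasser–Sipser protocol and Thm. 3.12.
By contrast Lemma 5.1 follows from Thm. 4.2 in half a page (p. 29: the `NP` ensemble
`L_{⟨t,s⟩} = {x | K^t(x) ≤ s}`, `|L_{⟨t,s⟩}| ≤ 2^{s+1}` by Fact 3.7, then `Gap_τ(K vs K)` reduces to the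
compression problem) — the inline step worth taking next (it makes `Hirahara2021_gapKvsK_mem_PromiseP` a
theorem relative to Thm. 4.2). Under the stronger hypothesis `DistNP ⊆ AvgP` (available along
`hirahara_UP_DistNP`), `h34` is the tree's named fact `BuhrmanFortnowPavan2004_PromiseBPP'_subset_PromiseP`
(`AvgCaseDerandomization.lean`; see `hirahara_UP_DistNP_of_nonempty_of_BFP` in
`Cryptography/AverageCaseProofs.lean`).

**Thm. 5.2 (weak symmetry of information) is an inline hypothesis, not a named fact** (D-0026 review
of the decomposition, 2026-08-15, with TR21-058 p. 30 open). Its printed proof (one page) is NOT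
self-contained relative to the tree: it invokes (i) Lemma 5.1 — a polynomial `τ` and a polynomial-time
algorithm `A` for `Gap_τ MINKT` (the sibling fact `Hirahara2021_gapKvsK_mem_PromiseP`, itself resting on
Thm. 4.2); (ii) Thm. 3.12 in its *Kolmogorov* form "`K^{p(ns/ε)}(x | D) ≤ k + log p(ns/ε)`" for the
*randomised* polynomial-time distinguisher `D(ω; w) := A(ω·w, 1^{2t}, 1ˢ)` (randomness `w ← {0,1}^m`),
which rests on Lemma 3.4's generator and is not in the tree — the enumeration form `h312` used by
Claim 8.11 does not substitute for it (fixing `w` by averaging puts `m` bits into the description of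
`x`, which destroys the `+m` of the conclusion, and an enumeration in time `poly(2^k)` is not a
polynomial budget for `k ≈ K(x)`); (iii) Fact 3.7 (`UniversalMachine.ncard_setOf_ktAt_lt`); (iv) the
program transformation `K^{2t}(DP_k(x; z)·w) ≤ K^t(xw) + d + O(log dm)` for `t ≥ p₀(nm)`, which for the
tree's abstract `UniversalMachine` (polynomial simulation overhead, budgets in `U`-steps) reads
`K^{q(t)}(DP_k(x; z)·w) ≤ K^t(xw) + d + O(log(tnkd))` for a polynomial `q` and is obtained from
`UniversalMachine.sim` applied to the two-stage machine "expand the binary header `⟨t, n, k, |Π|⟩` to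
unary rulers (`Complexity.mapFstAux` over the `2^{O(|header|)} = poly(t)`-time pad `Complexity.lpad`),
then run `Π` for `t` steps (`mem_FP_of_unaryArg U.polyTime`), split `x ‖ w`, output `DP_k(x; z) ‖ w`
(`FP` bricks, `Cryptography.glFn`)" (`Turing.TM2ComputableAux.comp_outputsWithin`). So the closed fact
could only be discharged after its sibling Lemma 5.1 and after a second, unvendored corollary of
Thm. 3.12; decompositions do not recurse (D-0026), hence the statement is carried here exactly as
Lemma 3.4 and Thm. 3.12 are: as the hypothesis `h52` of the conditional theorems, in the printed
(success) form, `∀ U`. The theorem to prove when (ii) becomes available is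
`∀ U τ, U.gapKvsK τ ∈ PromiseP → (Thm. 3.12, K-form, randomised P-tests) → ∃ p₀ p_w, …` by the p. 30
argument: `s := d + k + m - log τ(d+k+m+q(t)) - log(2/ε) - 1`, the bad `w` (small `K^t(xw)`) make every
`DP_k(x; z)·w` a yes-instance, Fact 3.7 bounds the acceptance probability on uniform `ω·w` by `ε/2`,
reconstruction with `k := K^{p_DP}(x) - log p_DP - 1` gives the contradiction.

## References

* S. Hirahara, ECCC TR21-058: Thm. 8.9 and its proof (pp. 40–42), Lemma 3.4 (p. 20, used p. 27),
  Thm. 3.12 and the remark following it (p. 23), Thm. 4.2, Lemma 5.1, Thm. 5.2, Def. 8.8, Fact 8.4.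
-/

namespace Literature.Computability.MetaComplexity

open _root_.Computability Complexity Complexity.Classes Complexity.Nondeterministic Brick

namespace UniversalMachine

variable (U : UniversalMachine)

/-- **Thm. 5.2, success form ⟹ failure form, for given polynomials.** For one universal machine
`U` and polynomials `p₀, p_w`, the printed conclusion of Thm. 5.2 (weak symmetry of information),
`Pr_{w ← {0,1}^m}[K^t(xw) + log p_w(t/ε) ≥ K^{p_w(t/ε)}(x) + m] ≥ 1 - ε` for all `n, m`, `t ≥ p₀(nm)`,
`ε = 1/e`, `x ∈ {0,1}ⁿ`, gives the bound `≤ ε` on the complementary event (`Pr[E] + Pr[Eᶜ] = 1`,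
`uniformProb_compl`) — the failure form consumed by `hasSearchUHS_of_ingredients` (Claim 8.10).
[Hirahara 2021 (ECCC TR21-058), Thm. 5.2 (statement, p. 30)] [cite: Hirahara2021, Thm. 5.2] -/
theorem weakSOI_failure_le {p₀ pw : Polynomial ℕ}
    (h : ∀ (n m t e : ℕ) (x : List Bool), x.length = n → p₀.eval (n * m) ≤ t → 1 ≤ e →
      1 - 1 / (e : ℝ) ≤ uniformProb m
        {w | U.ktAt (pw.eval (t * e)) x + m ≤ U.ktAt t (x ++ w) + Nat.log 2 (pw.eval (t * e))})
    (n m t e : ℕ) (x : List Bool) (hx : x.length = n) (ht : p₀.eval (n * m) ≤ t) (he : 1 ≤ e) :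
    uniformProb m
        {w | U.ktAt t (x ++ w) + Nat.log 2 (pw.eval (t * e)) < U.ktAt (pw.eval (t * e)) x + m} ≤
      1 / (e : ℝ) := by
  have h1 := h n m t e x hx ht he
  have hcompl : {w : List Bool | U.ktAt t (x ++ w) + Nat.log 2 (pw.eval (t * e)) <
      U.ktAt (pw.eval (t * e)) x + m} =
      {w | U.ktAt (pw.eval (t * e)) x + m ≤ U.ktAt t (x ++ w) + Nat.log 2 (pw.eval (t * e))}ᶜ := by
    ext w
    simp
  rw [hcompl, uniformProb_compl]
  linarith

/-- **Thm. 8.9 for one `UP`-type verifier, from the ingredients as data about `U`.** Given `R ∈ P`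
with at most one certificate per input, a polynomial `τ` with `Gap_τ(K vs K) ∈ pr-P` (Lemma 5.1), a
polynomial `p♯` with the compression problem of `L'` in `pr-P` (Thm. 4.2), `PromiseBPP' ⊆ PromiseP`
(Lemma 3.4), the enumeration form of Thm. 3.12 for polynomial-time tests, and the polynomials of weak
symmetry of information (Thm. 5.2, failure form), the search problem of `(R, p)` admits a universal
heuristic scheme: the toolkit of `UPSearchScheme.lean` is assembled (`KtApproximation`,
`AccProbTester`, the slices of `upLang`), its scheme is correct (`UPToolkit.scheme_correct`) and
polynomial-time (`UPSearchMachines`). [Hirahara 2021 (ECCC TR21-058), Thm. 8.9 (proof)]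
[cite: Hirahara2021, Thm. 8.9 (proof)] -/
theorem hasSearchUHS_of_ingredients {R : Language Bool} (hR : R ∈ P) (p : Polynomial ℕ)
    (hsub : ∀ x : List Bool, (certSet R p x).Subsingleton)
    {τ : Polynomial ℕ} (h51 : U.gapKvsK (fun m => τ.eval m) ∈ PromiseP)
    {pc : Polynomial ℕ} (h42 : U.compressionProblem (U.upLang R p) (fun t => pc.eval t) ∈ PromiseP)
    (h34 : PromiseBPP' ⊆ PromiseP)
    (h312 : ∀ D₀ : Language Bool, D₀ ∈ P → ∃ E : List Bool → List Bool, E ∈ FP ∧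
      ∀ (a x : List Bool) (k e : ℕ), 1 ≤ e →
        1 / (e : ℝ) ≤ dpAdvantage k x (fun w => D₀.boolIndicator (boolPair a w)) →
          x ∈ decNil (E (dpEnumEnc a x.length k e)))
    {p₀ pw : Polynomial ℕ} (h52 : ∀ (n m t e : ℕ) (x : List Bool), x.length = n → p₀.eval (n * m) ≤ t → 1 ≤ e →
      uniformProb m {w | U.ktAt t (x ++ w) + Nat.log 2 (pw.eval (t * e)) < U.ktAt (pw.eval (t * e)) x + m} ≤
        1 / (e : ℝ)) :
    U.HasSearchUHS R p := by
  classical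
  -- Lemma 5.1 + Fact 3.8: the approximation of `K^t(x)`
  obtain ⟨c₀, a₀, sK, hsKpoly, hkt, hsKge, hsKle⟩ := U.exists_ktApprox_of_gapKvsK_mem_PromiseP h51
  -- Thm. 4.2: the separator of the compression problem of `L'`
  obtain ⟨Sep, hSepP, hyes, hno⟩ := h42
  -- Lemma 3.4: the derandomised estimator
  obtain ⟨T, hTP, hTc, hTs⟩ := exists_accTester h34 hSepP
  -- Thm. 3.12: the enumerator for the tests `w ↦ [(x ‖ w, 1^ι) ∈ Sep]`
  set D₀ : Language Bool :=
    ((fun v : List Bool => paramEnc (fstF (fstF v) ++ sndF v, (sndF (fstF v)).length)) ⁻¹' Sep : Set (List Bool))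
    with hD₀
  have hD₀P : D₀ ∈ P := by
    refine preimage_mem_P hSepP ?_
    have : (fun v : List Bool => paramEnc (fstF (fstF v) ++ sndF v, (sndF (fstF v)).length)) =
        fanoutFn (fun v => (fstF ∘ fstF) v ++ sndF v) (onesFn ∘ sndF ∘ fstF) := by
      funext v
      simp [fanoutFn_apply, paramEnc, onesFn]
    rw [this]
    exact fanoutFn_mem_FP (append_mem_FP (comp_mem_FP fstF_mem_FP fstF_mem_FP) sndF_mem_FP)
      (comp_mem_FP onesFn_mem_FP (comp_mem_FP sndF_mem_FP fstF_mem_FP))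
  obtain ⟨E, hEFP, hE⟩ := h312 D₀ hD₀P
  have hD₀test : ∀ (x : List Bool) (ι : ℕ),
      (fun w => D₀.boolIndicator (boolPair (boolPair x (unaryEncodeNat ι)) w)) = sepTest Sep x ι := by
    intro x ι
    funext w
    have hmem : boolPair (boolPair x (unaryEncodeNat ι)) w ∈ D₀ ↔ paramEnc (x ++ w, ι) ∈ Sep := by
      change paramEnc (fstF (fstF (boolPair (boolPair x (unaryEncodeNat ι)) w)) ++
          sndF (boolPair (boolPair x (unaryEncodeNat ι)) w),
        (sndF (fstF (boolPair (boolPair x (unaryEncodeNat ι)) w))).length) ∈ Sep ↔ _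
      rw [fstF_boolPair, sndF_boolPair, fstF_boolPair, sndF_boolPair, OracleCompose.unaryEncodeNat_eq_replicate,
        List.length_replicate]
    rw [sepTest, Bool.eq_iff_iff, ← Set.mem_iff_boolIndicator, ← Set.mem_iff_boolIndicator]
    exact hmem
  -- the toolkit
  let K : U.UPToolkit R p :=
    { c₀ := c₀, a₀ := a₀, kt_le := hkt, τ := τ, sK := sK, sK_ge := hsKge, sK_le := hsKle,
      pc := pc, M := Sep,
      yes_mem := fun n k t s v hv => hyes ((U.paramEnc_mem_compressionProblem_yes_iff _ _).2
        (by rw [languageSlice_upLang_idx4]; exact hv)),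
      no_not_mem := fun n k t s v hlt hmem => hno ((U.paramEnc_mem_compressionProblem_no_iff _ _).2
        (by rw [languageSlice_upLang_idx4]; exact hlt)) hmem,
      Tst := fun x ι m => T.boolIndicator (schemeEnc (x, ι, m)),
      tst_complete := fun x ι m h => (Set.mem_iff_boolIndicator _ _).1 (hTc x ι m h),
      tst_sound := fun x ι m h => hTs x ι m ((Set.mem_iff_boolIndicator _ _).2 h),
      enum := fun x ι k => decNil (E (dpEnumEnc (boolPair x (unaryEncodeNat ι)) (p.eval x.length + 1) k 3)),
      enum_spec := fun x ι k u hu hadv => by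
        have h := hE (boolPair x (unaryEncodeNat ι)) u k 3 (by norm_num) (by rw [hD₀test]; simpa using hadv)
        rwa [hu] at h,
      p₀ := p₀, pw := pw, soi := h52 }
  -- correctness and running time
  obtain ⟨c, q, hq⟩ := K.scheme_correct hsub
  refine ⟨K.solver c, K.checker c, ?_⟩
  exact
    { solver_polyTime := K.solver_polyTimeComputable c hsKpoly hEFP (fun _ _ _ => rfl) hR
      checker_polyTime := K.checker_polyTimeComputable c hsKpoly hTP (fun _ _ _ => rfl)
      exists_polynomial := ⟨q, fun x t k hqt => ⟨(hq x t k hqt).1, fun hC hx => (hq x t k hqt).2 hC hx⟩⟩ }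

end UniversalMachine

/-- **Hirahara 2021, Thm. 8.9 for `UP`-type verifiers, from its five ingredients.** The named fact
`Hirahara2021_UP_searchUHS_of_Avg1P` follows from Lemma 5.1 (`Hirahara2021_gapKvsK_mem_PromiseP`) and
Thm. 4.2 (`Hirahara2021_languageCompression`), together with Thm. 5.2 (weak symmetry of information)
in its printed form (`h52`: *if `coNP × {U, T} ⊆ Avg¹_{1-n^{-c}} P` for some `c`, then there exist
polynomials `p₀, p_w` such that for any `n, m`, any `t ≥ p₀(nm)`, any `ε > 0` and any `x ∈ {0,1}ⁿ`,
`Pr_{w ← {0,1}^m}[K^t(xw) ≥ K^{p_w(t/ε)}(x) + m - log p_w(t/ε)] ≥ 1 - ε`*; `ε = 1/e`, `t/ε = t·e`,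
`log = Nat.log 2`, the inequality in `ℕ∞` without subtraction, `∀ U`), Lemma 3.4 in promise form
(`h34`: the hypothesis implies `pr-BPP = pr-P`, as the paper uses it on p. 27 and in Eq. (13)) and
Thm. 3.12 in enumeration form for polynomial-time tests with auxiliary input (`h312`: the remark
printed after Thm. 3.12, applied to the circuits `w ↦ [⟨a, w⟩ ∈ D₀]`), by the formalised proof of
Thm. 8.9: `L' ∈ NP` (`UPSearchNP`), Fact 3.8 (`KtApproximation`), Eq. (13) (`AccProbTester`),
Claims 8.10–8.11 and the parameters (`UPSearchScheme`), polynomial time (`UPSearchMachines`).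
(Thm. 5.2 is an inline hypothesis and not a named fact: see the module docstring, "Size of what
remains".) [Hirahara 2021 (ECCC TR21-058), Thm. 8.9, with Lemma 3.4, Thm. 3.12, Thm. 4.2, Lemma 5.1,
Thm. 5.2 and Fact 8.4] [cite: Hirahara2021, Thm. 8.9] -/
theorem Hirahara2021_UP_searchUHS_of_Avg1P_of (h51 : Hirahara2021_gapKvsK_mem_PromiseP)
    (h42 : Hirahara2021_languageCompression)
    (h52 : ∀ U : UniversalMachine,
      (∃ c : ℕ, distClass coNP {uniformEnsemble, tallyEnsemble} ⊆
        Avg1DeltaP fun n => 1 - 1 / (n : ℝ) ^ c) →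
      ∃ p₀ pw : Polynomial ℕ, ∀ (n m t e : ℕ) (x : List Bool), x.length = n → p₀.eval (n * m) ≤ t →
        1 ≤ e →
          1 - 1 / (e : ℝ) ≤ uniformProb m
            {w | U.ktAt (pw.eval (t * e)) x + m ≤ U.ktAt t (x ++ w) + Nat.log 2 (pw.eval (t * e))})
    (h34 : (∃ c : ℕ, distClass coNP {uniformEnsemble, tallyEnsemble} ⊆
        Avg1DeltaP fun n => 1 - 1 / (n : ℝ) ^ c) → PromiseBPP' ⊆ PromiseP)
    (h312 : (∃ c : ℕ, distClass coNP {uniformEnsemble, tallyEnsemble} ⊆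
        Avg1DeltaP fun n => 1 - 1 / (n : ℝ) ^ c) →
      ∀ D₀ : Language Bool, D₀ ∈ P → ∃ E : List Bool → List Bool, E ∈ FP ∧
        ∀ (a x : List Bool) (k e : ℕ), 1 ≤ e →
          1 / (e : ℝ) ≤ dpAdvantage k x (fun w => D₀.boolIndicator (boolPair a w)) →
            x ∈ decNil (E (dpEnumEnc a x.length k e))) :
    Hirahara2021_UP_searchUHS_of_Avg1P := by
  intro U hyp R p hR hsub
  obtain ⟨τ, hτ⟩ := h51 U hyp
  obtain ⟨pc, hpc⟩ := h42 U hyp (U.upLang R p) (U.upLang_mem_NP hR p) (UniversalMachine.isLanguageEnsemble_upLang R p)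
  obtain ⟨p₀, pw, hsoi⟩ := h52 U hyp
  exact U.hasSearchUHS_of_ingredients hR p hsub hτ hpc (h34 hyp) (h312 hyp) (U.weakSOI_failure_le hsoi)

/-- **Hirahara 2021, Cor. 8.12 for `UP`, from the five ingredients of Thm. 8.9.** *If
`coNP × {U, T} ⊆ Avg¹_{1-n^{-c}} P` for some constant `c`, then every `L ∈ UP` admits a universal
heuristic scheme* (w.r.t. every efficient universal machine; the statement is written out exactly as
the conclusion of `Hirahara2021_UP_hasUHS_of_Avg1P_of_search`, Cor. 8.12 for `UP` being a proved
theorem of the tree and not a named fact) follows from Lemma 5.1, Thm. 4.2 (the tree's named facts),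
Thm. 5.2 (printed form, inline hypothesis `h52` as in `Hirahara2021_UP_searchUHS_of_Avg1P_of`),
Lemma 3.4 (promise form) and Thm. 3.12 (enumeration form): Thm. 8.9 for the `UP`-type verifier of `L`
(`Hirahara2021_UP_searchUHS_of_Avg1P_of`), then "a decision problem reduces to its search version"
(`Hirahara2021_UP_hasUHS_of_Avg1P_of_search`, the printed proof of Cor. 8.12).
[Hirahara 2021 (ECCC TR21-058), Cor. 8.12 with Thm. 8.9 and Fact 8.4; Lemma 3.4, Thm. 3.12, Thm. 4.2,
Lemma 5.1, Thm. 5.2] [cite: Hirahara2021, Cor. 8.12] -/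
theorem Hirahara2021_UP_hasUHS_of_Avg1P_of_ingredients (h51 : Hirahara2021_gapKvsK_mem_PromiseP)
    (h42 : Hirahara2021_languageCompression)
    (h52 : ∀ U : UniversalMachine,
      (∃ c : ℕ, distClass coNP {uniformEnsemble, tallyEnsemble} ⊆
        Avg1DeltaP fun n => 1 - 1 / (n : ℝ) ^ c) →
      ∃ p₀ pw : Polynomial ℕ, ∀ (n m t e : ℕ) (x : List Bool), x.length = n → p₀.eval (n * m) ≤ t →
        1 ≤ e →
          1 - 1 / (e : ℝ) ≤ uniformProb m
            {w | U.ktAt (pw.eval (t * e)) x + m ≤ U.ktAt t (x ++ w) + Nat.log 2 (pw.eval (t * e))})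
    (h34 : (∃ c : ℕ, distClass coNP {uniformEnsemble, tallyEnsemble} ⊆
        Avg1DeltaP fun n => 1 - 1 / (n : ℝ) ^ c) → PromiseBPP' ⊆ PromiseP)
    (h312 : (∃ c : ℕ, distClass coNP {uniformEnsemble, tallyEnsemble} ⊆
        Avg1DeltaP fun n => 1 - 1 / (n : ℝ) ^ c) →
      ∀ D₀ : Language Bool, D₀ ∈ P → ∃ E : List Bool → List Bool, E ∈ FP ∧
        ∀ (a x : List Bool) (k e : ℕ), 1 ≤ e →
          1 / (e : ℝ) ≤ dpAdvantage k x (fun w => D₀.boolIndicator (boolPair a w)) →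
            x ∈ decNil (E (dpEnumEnc a x.length k e))) :
    ∀ U : UniversalMachine,
      (∃ c : ℕ, distClass coNP {uniformEnsemble, tallyEnsemble} ⊆
        Avg1DeltaP fun n => 1 - 1 / (n : ℝ) ^ c) →
      ∀ L ∈ UP, U.HasUniversalHeuristicScheme L :=
  Hirahara2021_UP_hasUHS_of_Avg1P_of_search (Hirahara2021_UP_searchUHS_of_Avg1P_of h51 h42 h52 h34 h312)

end Literature.Computability.MetaComplexity
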